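import Summits.ResolutionOfSingularities.ResolutionOfSingularities.Theorems.EquisingularLiftEquisingularLiftNatExceptionalReducedModel
import Summits.ResolutionOfSingularities.ResolutionOfSingularities.Theorems.EquisingularLiftEquisingularLiftNatPointPlaneModel
import Summits.ResolutionOfSingularities.ResolutionOfSingularities.Theorems.EquisingularLiftEquisingularLiftNatSubchainSupplierInvSLDefs
import Summits.ResolutionOfSingularities.ResolutionOfSingularities.Theorems.EquisingularLiftEquisingularLiftNatDirZeroDefs
import HarnessLib

/-!
# [OURS · L1 W4.5(b) · EL♮(3) · WIDTH TABLE D5 «IMMATURE HOST», supplier row HPAIR, input (EB)] THE EXCEPTIONAL LETTER OF A CURVE ROUND IS BORN WITH ITS MODEL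
# `TCPlus.excLetter_birth k : <(EB) of ✓ TCPlus.hpair_supplier_of (p670305), verbatim>` — the curve twin of ✓ `TCPlus.letterDatum_newPlane`

res-L1-w45b-stub-2 g16.  OURS; NOT a statement of any manuscript ([Hironaka2017] is a candidate under adjudication, nothing of it is asserted); AI-written,
weaker than expert review.  No `sorry`; standard axioms; DEF-FREE.  `--supports stmt-ResolutionOfSingularities-20148 --as helper`.

WHAT.  In a model square `jG : G ⟶ X` over `Spec θ` (`O` a DVR, `θ : O ↠ k`), for a centre `C` on the regular `X` with `V(C)` regular, `O`-flat, off `Y`,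
reduced trace `C·𝒪_G = 𝓘⟨Z⟩` and quasi-regular 2-frames at its support, the blow-up `τ = Bl_C`, the downstairs blow-up `υ₂ = Bl_Z` and the new
model square `j₂` (`j₂ ≫ τ = υ₂ ≫ jG`): the exceptional letter `υ₂⁻¹ Z` carries `TCPlus.LetterDatum O P q Y G₂ X₂ (τ ≫ σ) j₂ (υ₂⁻¹ Z)` with model
`C·𝒪_{X₂}` — (l-i) REDUCED TRACE by res-D-pv-029's ✓ `comap_comap_eq_vanishingIdeal_preimage_of_model` (frames UPSTAIRS suffice; no downstairs regularity
is used), (l-ii) ✓ `isPrincipal_stalkIdeal_comap_of_isBlowup`, (l-iii) Literature ✓ `IsBlowup.isRegular_subscheme_comap` (Liu 8.1.19 (b)), (l-iv) ✓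
`image_support_comap_subset`, (l-v) ✓ `flat_exceptional_of_isBlowup_regularCentre`.  The statement is the (EB) hypothesis of ✓ `TCPlus.hpair_supplier_of`
VERBATIM (several of its binders — `X₂` regular, `C ≠ ⊥`, the downstairs regularity/curve clauses — are not needed and are ignored).
[cite: Liu2002, Thm. 8.1.19] [folklore; pure composition of the cited tree theorems]
-/

set_option linter.dupNamespace false -- mandated namespace `Summit.<Summit>.<Problem>` of this single-conjunct summit
set_option linter.overlappingInstances false -- signatures carry `[IsDomain O] [IsDiscreteValuationRing O]`

noncomputable section

open CategoryTheory CategoryTheory.Limits AlgebraicGeometry TopologicalSpace Topology IsLocalRing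
open Literature.AlgebraicGeometry.Resolution
open AlgebraicGeometry.Scheme.IdealSheafData
open Summit.ResolutionOfSingularities.ResolutionOfSingularities.Cruxes.EquisingularLift.StrataSplit

namespace Summit.ResolutionOfSingularities.ResolutionOfSingularities.Cruxes.EquisingularLiftNat.Sections

/-- **(EB) THE EXCEPTIONAL LETTER OF A CURVE ROUND IS BORN WITH THE MODEL `C·𝒪_{X₂}`** — the (EB) input of ✓ `TCPlus.hpair_supplier_of`, verbatim
(see the module docstring). [cite: Liu2002, Thm. 8.1.19] [OURS · L1 W4.5b · WIDTH TABLE D5, supplier row HPAIR (EB)] -/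
theorem TCPlus.excLetter_birth (k : Type) [Field k] :
    ∀ (O : Type) [CommRing O] [IsDomain O] [IsDiscreteValuationRing O] (θ : O →+* k), Function.Surjective θ →
      ∀ {P X X₂ G G₂ : AlgebraicGeometry.Scheme.{0}} (q : P ⟶ AlgebraicGeometry.Spec (.of O)) (Y : Set P) (σ : X ⟶ P)
        [IsLocallyNoetherian X] [AlgebraicGeometry.IsIntegral X] [IsLocallyNoetherian X₂] [AlgebraicGeometry.IsIntegral X₂]
        [IsLocallyNoetherian G] [AlgebraicGeometry.IsIntegral G] [IsLocallyNoetherian G₂] [AlgebraicGeometry.IsIntegral G₂] [AlgebraicGeometry.IsProper (σ ≫ q)],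
        Literature.AlgebraicGeometry.Resolution.Scheme.IsRegular X → Literature.AlgebraicGeometry.Resolution.Scheme.IsRegular X₂ →
      ∀ (jG : G ⟶ X) (tG : G ⟶ AlgebraicGeometry.Spec (.of k)), IsPullback jG tG (σ ≫ q) (AlgebraicGeometry.Spec.map (CommRingCat.ofHom θ)) →
      -- the centre: a regular `O`-flat relative curve with reduced trace `𝓘⟨Z⟩`, 2-frames, off `Y`; downstairs `Z̃` regular, a curve, `G` regular along `Z`
      ∀ (C : X.IdealSheafData) (Z : Set G) (hZ : IsClosed Z),
        C.comap jG = AlgebraicGeometry.Scheme.IdealSheafData.vanishingIdeal (⟨Z, hZ⟩ : TopologicalSpace.Closeds G) → AlgebraicGeometry.Flat (C.subschemeι ≫ σ ≫ q) →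
        Literature.AlgebraicGeometry.Resolution.Scheme.IsRegular C.subscheme → C ≠ ⊥ →
        (∀ x ∈ C.support, ∃ c : Fin 2 → X.presheaf.stalk x, Ideal.span (Set.range c) = Literature.AlgebraicGeometry.Resolution.stalkIdeal C x ∧ IsQuasiRegular c) →
        σ '' (C.support : Set X) ⊆ {p : P | ¬ IsGenericPoint p Y} →
        (∀ z : ↥(redSub G Z hZ), IsRegularLocalRing ((redSub G Z hZ).presheaf.stalk z)) →
        (∀ z : ↥(redSub G Z hZ), IsClosed ({z} : Set ↥(redSub G Z hZ)) → ringKrullDim ((redSub G Z hZ).presheaf.stalk z) = ((1 : ℕ) : WithBot ℕ∞)) →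
        (∀ z ∈ Z, IsClosed ({z} : Set G) → IsRegularLocalRing (G.presheaf.stalk z)) →
      -- the round upstairs and downstairs, the new model square
      ∀ {τ : X₂ ⟶ X}, Literature.AlgebraicGeometry.Resolution.IsBlowup τ C →
      ∀ {υ₂ : G₂ ⟶ G}, Literature.AlgebraicGeometry.Resolution.IsBlowup υ₂ (AlgebraicGeometry.Scheme.IdealSheafData.vanishingIdeal (⟨Z, hZ⟩ : TopologicalSpace.Closeds G)) →
      ∀ (j₂ : G₂ ⟶ X₂) (t₂ : G₂ ⟶ AlgebraicGeometry.Spec (.of k)), IsPullback j₂ t₂ ((τ ≫ σ) ≫ q) (AlgebraicGeometry.Spec.map (CommRingCat.ofHom θ)) → j₂ ≫ τ = υ₂ ≫ jG →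
      -- (EB) the round's exceptional letter `υ₂⁻¹ Z` is BORN with the model `C·𝒪_{X₂}`
      TCPlus.LetterDatum O P q Y G₂ X₂ (τ ≫ σ) j₂ (υ₂ ⁻¹' Z) := by
  intro O _ _ _ θ hθ P X X₂ G G₂ q Y σ _ _ _ _ _ _ _ _ _ hXreg _ jG tG hsq C Z hZ hCZ hCfl hCreg _ hfr hoff _ _ _ τ hτ υ₂ _ j₂ t₂ hsq₂ hcomm
  have hZcl : IsClosed (υ₂ ⁻¹' Z) := hZ.preimage υ₂.continuous
  have hcl : (⟨closure (υ₂ ⁻¹' Z), isClosed_closure⟩ : Closeds G₂) = ⟨υ₂ ⁻¹' Z, hZcl⟩ := Closeds.ext hZcl.closure_eq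
  refine ⟨C.comap τ, ?_, isPrincipal_stalkIdeal_comap_of_isBlowup C hτ, hτ.isRegular_subscheme_comap hXreg hCreg,
    image_support_comap_subset C τ σ hoff, ?_⟩
  · -- (l-i) the REDUCED trace: frames upstairs, res-D-pv-029's model-square lemma
    rw [hcl]
    have hsq₂' : IsPullback j₂ t₂ (τ ≫ σ ≫ q) (Spec.map (CommRingCat.ofHom θ)) := by simpa only [Category.assoc] using hsq₂
    have hqr : ∀ z ∈ ((⟨Z, hZ⟩ : Closeds G) : Set G), ∃ (n : ℕ) (c : Fin n → X.presheaf.stalk (jG z)),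
        Ideal.span (Set.range c) = stalkIdeal C (jG z) ∧ IsQuasiRegular c := by
      intro z hz
      have hmem : jG z ∈ C.support := by
        have h1 : z ∈ ((C.comap jG).support : Set G) := by
          rw [hCZ, Scheme.IdealSheafData.coe_support_vanishingIdeal]; exact hz
        rw [support_comap] at h1
        exact h1
      obtain ⟨c, hc, hq⟩ := hfr _ hmem
      exact ⟨2, c, hc, hq⟩
    exact comap_comap_eq_vanishingIdeal_preimage_of_model O k θ hθ (σ ≫ q) jG tG hsq C τ hτ j₂ t₂ hsq₂' υ₂ hcomm ⟨Z, hZ⟩ hCZ hqr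
  · -- (l-v) the exceptional divisor is flat over `O`
    have h := flat_exceptional_of_isBlowup_regularCentre O X X₂ (σ ≫ q) C hXreg hCreg hCfl τ hτ
    simpa only [Category.assoc] using h

end Summit.ResolutionOfSingularities.ResolutionOfSingularities.Cruxes.EquisingularLiftNat.Sections

end
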